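import Summits.BirchSwinnertonDyer.BirchSwinnertonDyer.Theorems.BiquadraticEisensteinDescentHeegnerTwistCouplingInSupplySymbolicMonskyDesign
import HarnessLib

set_option linter.dupNamespace false -- `Summit.BirchSwinnertonDyer.BirchSwinnertonDyer.Theorems.…` (summit = sub)
set_option autoImplicit false

/-!
# Crux `HeegnerTwistCouplingInSupply` (stmt-BirchSwinnertonDyer-21381) — Z-DESIGNS, the TWO-STAGE criterion (order `w`, then `u`) for the
# EXCEPTIONAL class (`t_pred > t₀`, memo THEOREM-A-w3g22 §0.5 / §6 = THEOREM B)

Route `BiquadraticEisensteinDescent` (cell `pub/bsd-wall`, width seat `bsd-wall-cm-bed-w3` g22; `--supports` 21381, helper). Companion of the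
one-stage criterion `…SymbolicMonskyDesign` (ρ bijective on `𝒦⁺`, possible only with `τ = τ₀` free cells). For the exceptional configurations
(`κ_u + ε > τ₀`; aligned `r_i ≡ 5 (8)` class; 2 of 4096 at `k = 3`) a pattern-free recipe needs `τ = κ_u + ε > τ₀` free cells and TWO genuine stages
of the closure criterion: first the direction `w` (hypothesis (W): the pairs `(a, e)` orthogonal to `ρ(𝒦⁺)` all have `e = 0`), then, with the
`w`-rows of the auxiliary block available (`⟨σ_i, w⟩ + w₁ c_i = 0`), the direction `u` (hypothesis (U): the system «`(L+D_m)ũ + D_d w = Σ a_i σ_i`,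
`D_m ũ + L w = 0`, `Σ c_i a_i = 0`, `Sᵀw = w₁ c`» forces `a = 0`), and finally S3 from (F) (`design_S3`). In memo language: (W) `π_u(𝒦⁺_Z) + Z = V`,
(U) `R(𝒫_Z) ∩ (Z+1)^⊥ = 0` (⇔ the Schur condition `rank C|_N = 2 dim N − μ − 1`), (F) `𝒦⁺ ∩ (Z ⊕ Z) = 0`; for `μ = 1` these are equivalent to
(i) `V = A⁺ ⊕ Z`, (ii) `Z ∩ 𝒲⁺ = 0`, (iii) `1 ∉ A ⊕ Z` or `⟨d, a₁⟩ = 1` (verified on 101 580 designs) and such `Z` always exist (memo §6) — the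
existence half of THEOREM B is NOT in this file (it supplies only the criterion the existence proof will discharge).

* `design_stageW` — (W) ⇒ every `z` killed by the base rows and the two auxiliary row-sums is `w`-constant on the auxiliary block;
* `design_stageU` — (U) ⇒ if moreover the `w`-rows of the auxiliary block vanish, `z` is `u`-constant there;
* ★★ `det_dataK_design_eq_one_of_stages` / `design_recipe_of_stages` — (W) ∧ (U) ∧ (F) ⇒ `heegnerK ∧ ∀ pat, det = 1`.

HONEST FRAMING: linear algebra over `𝔽₂`; RUNG-LEVEL corner layer; the crux (C⁺), its registered stubs and BSD are untouched; nothing is closed.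
THEOREMS ONLY. Reference: [HeathBrown1994] appendix (Monsky), typescript pp. 39–41.
-/

namespace Summit.BirchSwinnertonDyer.BirchSwinnertonDyer.Theorems.SymbolicMonsky

section DesignTwoStage

open Matrix

variable {k : ℕ} (base : SymbData (k + 1)) (c₁ : AuxCell) (rest : List AuxCell)

/-- ★ **Stage `w` of a design** from hypothesis (W): every `z` killed by the base rows and the two auxiliary row-sums of the reference matrix is
constant on the auxiliary block in the direction `w = u + v`. [folklore] -/
theorem design_stageW (hm1 : negNegOne c₁.1 = true) (hmr : ∀ i : Fin rest.length, negNegOne (rest.getD i.val (0, 0)).1 = false)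
    (σ : Fin rest.length → Fin (k + 1) → ZMod 2) (hσ : ∀ i b, bz ((rest.getD i.val (0, 0)).2.testBit b.val) = σ i b)
    (hσ1 : ∀ b : Fin (k + 1), bz (c₁.2.testBit b.val) = bz (negNegOne (base.cls b)) + ∑ i, σ i b)
    (dp : Fin rest.length → ZMod 2) (hdp : ∀ i, bz (negTwo (rest.getD i.val (0, 0)).1) = dp i)
    (hd1 : bz (negTwo c₁.1) = ∑ i, dp i)
    (hW : ∀ a e : Fin rest.length → ZMod 2,
      (∀ x y : Fin (k + 1) → ZMod 2, (∀ i, (∑ j, bz (base.neg i j) * (x j + x i)) + bz (negNegOne (base.cls i)) * x i + bz (negTwo (base.cls i)) * y i = 0) →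
        (∀ i, bz (negNegOne (base.cls i)) * x i + ∑ j, bz (base.neg i j) * (y j + y i) = 0) →
        (∑ i, (a i * (∑ b, σ i b * y b) + e i * (∑ b, σ i b * x b))) = 0) →
      (∑ i, ((∑ b, σ i b) * a i + dp i * e i)) = 0 → ∀ i, e i = 0)
    (z : Fin (k + 1 + (c₁ :: rest).length) ⊕ Fin (k + 1 + (c₁ :: rest).length) → ZMod 2)
    (hrow1 : ∀ b : Fin (k + 1), ((dataK base (c₁ :: rest) (fun _ _ => false)).monskyOddS *ᵥ z) (Sum.inl (Fin.castAdd _ b)) = 0)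
    (hrow2 : ∀ b : Fin (k + 1), ((dataK base (c₁ :: rest) (fun _ _ => false)).monskyOddS *ᵥ z) (Sum.inr (Fin.castAdd _ b)) = 0)
    (hs1 : (∑ j : Fin (c₁ :: rest).length,
      ((dataK base (c₁ :: rest) (fun _ _ => false)).monskyOddS *ᵥ z) (Sum.inl (Fin.natAdd (k + 1) j))) = 0)
    (hs2 : (∑ j : Fin (c₁ :: rest).length,
      ((dataK base (c₁ :: rest) (fun _ _ => false)).monskyOddS *ᵥ z) (Sum.inr (Fin.natAdd (k + 1) j))) = 0) :
    ∀ i : Fin rest.length, z (Sum.inl (Fin.natAdd (k + 1) (⟨i.val + 1, by simp⟩ : Fin (c₁ :: rest).length))) + z (Sum.inr (Fin.natAdd (k + 1) (⟨i.val + 1, by simp⟩ : Fin (c₁ :: rest).length))) =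
      z (Sum.inl (Fin.natAdd (k + 1) (⟨0, by simp⟩ : Fin (c₁ :: rest).length))) + z (Sum.inr (Fin.natAdd (k + 1) (⟨0, by simp⟩ : Fin (c₁ :: rest).length))) := by
  set q0 : Fin (c₁ :: rest).length := ⟨0, by simp⟩ with hq0
  set U0 := z (Sum.inl (Fin.natAdd (k + 1) q0)) with hU0
  set V0 := z (Sum.inr (Fin.natAdd (k + 1) q0)) with hV0
  set U : Fin rest.length → ZMod 2 := fun i => z (Sum.inl (Fin.natAdd (k + 1) (⟨i.val + 1, by simp⟩ : Fin (c₁ :: rest).length))) with hUdef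
  set V : Fin rest.length → ZMod 2 := fun i => z (Sum.inr (Fin.natAdd (k + 1) (⟨i.val + 1, by simp⟩ : Fin (c₁ :: rest).length))) with hVdef
  obtain ⟨-, -, D3, -⟩ := design_identities base c₁ rest hm1 hmr σ hσ hσ1 dp hdp hd1 z hrow1 hrow2 hs1 hs2
  have Pr : ∀ x y : Fin (k + 1) → ZMod 2, (∀ i, (∑ j, bz (base.neg i j) * (x j + x i)) + bz (negNegOne (base.cls i)) * x i + bz (negTwo (base.cls i)) * y i = 0) →
      (∀ i, bz (negNegOne (base.cls i)) * x i + ∑ j, bz (base.neg i j) * (y j + y i) = 0) →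
      (∑ i, ((U i + U0) * (∑ b, σ i b * y b) + (((U i + V i) + (U0 + V0)) * (∑ b, σ i b * x b)))) = 0 :=
    fun x y hE1 hE2 => design_pairing base c₁ rest hm1 hmr σ hσ hσ1 dp hdp hd1 z hrow1 hrow2 hs1 hs2 x y hE1 hE2
  have D3' : (∑ i, ((∑ b, σ i b) * (U i + U0) + dp i * ((U i + V i) + (U0 + V0)))) = 0 := D3
  have he := hW (fun i => U i + U0) (fun i => (U i + V i) + (U0 + V0)) Pr D3'
  intro i
  exact (zmod_two_eq_iff_add_eq_zero _ _).mpr (he i)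

/-- ★ **Stage `u` of a design** from hypothesis (U): if `z` is killed by the base rows and the auxiliary row-sums, is `w`-constant on the auxiliary
block, and the `w`-rows (`half one + half two`) of the auxiliary indices vanish, then `z` is `u`-constant on the auxiliary block. [folklore] -/
theorem design_stageU (hm1 : negNegOne c₁.1 = true) (hmr : ∀ i : Fin rest.length, negNegOne (rest.getD i.val (0, 0)).1 = false)
    (σ : Fin rest.length → Fin (k + 1) → ZMod 2) (hσ : ∀ i b, bz ((rest.getD i.val (0, 0)).2.testBit b.val) = σ i b)
    (hσ1 : ∀ b : Fin (k + 1), bz (c₁.2.testBit b.val) = bz (negNegOne (base.cls b)) + ∑ i, σ i b)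
    (dp : Fin rest.length → ZMod 2) (hdp : ∀ i, bz (negTwo (rest.getD i.val (0, 0)).1) = dp i)
    (hd1 : bz (negTwo c₁.1) = ∑ i, dp i)
    (hU : ∀ (x y : Fin (k + 1) → ZMod 2) (γ : ZMod 2) (a : Fin rest.length → ZMod 2),
      (∀ b, (∑ b', bz (base.neg b b') * (x b' + x b)) + bz (negNegOne (base.cls b)) * x b + bz (negTwo (base.cls b)) * y b =
        ∑ i, σ i b * a i) →
      (∀ b, bz (negNegOne (base.cls b)) * x b + (∑ b', bz (base.neg b b') * (y b' + y b)) = 0) →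
      (∑ i, (∑ b, σ i b) * a i) = 0 → (∀ i, (∑ b, σ i b * y b) + γ * ∑ b, σ i b = 0) → ∀ i, a i = 0)
    (z : Fin (k + 1 + (c₁ :: rest).length) ⊕ Fin (k + 1 + (c₁ :: rest).length) → ZMod 2)
    (hrow1 : ∀ b : Fin (k + 1), ((dataK base (c₁ :: rest) (fun _ _ => false)).monskyOddS *ᵥ z) (Sum.inl (Fin.castAdd _ b)) = 0)
    (hrow2 : ∀ b : Fin (k + 1), ((dataK base (c₁ :: rest) (fun _ _ => false)).monskyOddS *ᵥ z) (Sum.inr (Fin.castAdd _ b)) = 0)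
    (hs1 : (∑ j : Fin (c₁ :: rest).length,
      ((dataK base (c₁ :: rest) (fun _ _ => false)).monskyOddS *ᵥ z) (Sum.inl (Fin.natAdd (k + 1) j))) = 0)
    (hs2 : (∑ j : Fin (c₁ :: rest).length,
      ((dataK base (c₁ :: rest) (fun _ _ => false)).monskyOddS *ᵥ z) (Sum.inr (Fin.natAdd (k + 1) j))) = 0)
    (hw : ∀ i : Fin rest.length, z (Sum.inl (Fin.natAdd (k + 1) (⟨i.val + 1, by simp⟩ : Fin (c₁ :: rest).length))) + z (Sum.inr (Fin.natAdd (k + 1) (⟨i.val + 1, by simp⟩ : Fin (c₁ :: rest).length))) =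
      z (Sum.inl (Fin.natAdd (k + 1) (⟨0, by simp⟩ : Fin (c₁ :: rest).length))) + z (Sum.inr (Fin.natAdd (k + 1) (⟨0, by simp⟩ : Fin (c₁ :: rest).length))))
    (hwr : ∀ j : Fin (c₁ :: rest).length, ((dataK base (c₁ :: rest) (fun _ _ => false)).monskyOddS *ᵥ z) (Sum.inl (Fin.natAdd (k + 1) j)) +
      ((dataK base (c₁ :: rest) (fun _ _ => false)).monskyOddS *ᵥ z) (Sum.inr (Fin.natAdd (k + 1) j)) = 0) :
    ∀ i : Fin rest.length, z (Sum.inl (Fin.natAdd (k + 1) (⟨i.val + 1, by simp⟩ : Fin (c₁ :: rest).length))) = z (Sum.inl (Fin.natAdd (k + 1) (⟨0, by simp⟩ : Fin (c₁ :: rest).length))) := by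
  set q0 : Fin (c₁ :: rest).length := ⟨0, by simp⟩ with hq0
  set U0 := z (Sum.inl (Fin.natAdd (k + 1) q0)) with hU0
  set V0 := z (Sum.inr (Fin.natAdd (k + 1) q0)) with hV0
  set U : Fin rest.length → ZMod 2 := fun i => z (Sum.inl (Fin.natAdd (k + 1) (⟨i.val + 1, by simp⟩ : Fin (c₁ :: rest).length))) with hUdef
  set V : Fin rest.length → ZMod 2 := fun i => z (Sum.inr (Fin.natAdd (k + 1) (⟨i.val + 1, by simp⟩ : Fin (c₁ :: rest).length))) with hVdef
  set u : Fin (k + 1) → ZMod 2 := fun b => z (Sum.inl (Fin.castAdd (c₁ :: rest).length b)) with hu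
  set v : Fin (k + 1) → ZMod 2 := fun b => z (Sum.inr (Fin.castAdd (c₁ :: rest).length b)) with hv
  obtain ⟨D1, D2, D3, D4⟩ := design_identities base c₁ rest hm1 hmr σ hσ hσ1 dp hdp hd1 z hrow1 hrow2 hs1 hs2
  have he0 : ∀ i, (U i + V i) + (U0 + V0) = 0 := fun i => by rw [hw i]; exact zmod_two_add_self _
  -- the identities with e = 0
  have hV0 : V0 = 0 := by
    have h : V0 = ∑ i, (∑ b', σ i b') * ((U i + V i) + (U0 + V0)) := D4
    rw [h]; exact Finset.sum_eq_zero fun i _ => by rw [he0 i, mul_zero]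
  have E1 : ∀ b, (∑ b', bz (base.neg b b') * ((u b' + U0) + (u b + U0))) + bz (negNegOne (base.cls b)) * (u b + U0) +
      bz (negTwo (base.cls b)) * (u b + v b) = ∑ i, σ i b * (U i + U0) := D1
  have E2 : ∀ b, bz (negNegOne (base.cls b)) * (u b + U0) + (∑ b', bz (base.neg b b') * ((u b' + v b') + (u b + v b))) = 0 := by
    intro b
    have h : bz (negNegOne (base.cls b)) * (u b + U0) + (∑ b', bz (base.neg b b') * ((u b' + v b') + (u b + v b))) =
        (∑ i, (∑ b', σ i b') * ((U i + V i) + (U0 + V0))) * bz (negNegOne (base.cls b)) + ∑ i, σ i b * ((U i + V i) + (U0 + V0)) := D2 b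
    rw [h]
    have h0 : (∑ i, (∑ b', σ i b') * ((U i + V i) + (U0 + V0))) = 0 :=
      Finset.sum_eq_zero fun i _ => by rw [he0 i, mul_zero]
    rw [h0, zero_mul, zero_add]
    exact Finset.sum_eq_zero fun i _ => by rw [he0 i, mul_zero]
  have E3 : (∑ i, (∑ b, σ i b) * (U i + U0)) = 0 := by
    have h : (∑ i, ((∑ b, σ i b) * (U i + U0) + dp i * ((U i + V i) + (U0 + V0)))) = 0 := D3
    rw [Finset.sum_add_distrib] at h
    have h0 : (∑ i, dp i * ((U i + V i) + (U0 + V0))) = 0 := Finset.sum_eq_zero fun i _ => by rw [he0 i, mul_zero]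
    rw [h0, add_zero] at h
    exact h
  -- the w-rows of the free cells: ⟨σ_i, w⟩ + W₀ c_i = 0
  have E4 : ∀ i : Fin rest.length, (∑ b, σ i b * (u b + v b)) + (U0 + V0) * ∑ b, σ i b = 0 := by
    intro i
    have h := hwr ⟨i.val + 1, by simp⟩
    rw [mulVec_inl_natAdd_expand, mulVec_inr_natAdd_expand, sum_bz_neg_aux_aux_design base c₁ rest hmr,
      sum_bz_neg_aux_aux_design base c₁ rest hmr, add_zero, add_zero] at h
    simp only [bz_neg_tail_castAdd base c₁ rest hmr σ hσ, List.getD_cons_succ, hdp] at h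
    have hN2 : bz (negNegTwo (rest.getD i.val (0, 0)).1) = dp i := by
      have h' := bz_negNegOne_add_bz_negNegTwo (rest.getD i.val (0, 0)).1
      rw [hmr i, hdp i] at h'
      have h0 : bz false = (0 : ZMod 2) := rfl
      rw [h0, zero_add] at h'
      exact h'
    rw [hN2] at h
    have hWi : z (Sum.inl (Fin.natAdd (k + 1) (⟨i.val + 1, by simp⟩ : Fin (c₁ :: rest).length))) + z (Sum.inr (Fin.natAdd (k + 1) (⟨i.val + 1, by simp⟩ : Fin (c₁ :: rest).length))) = U0 + V0 := hw i
    have h' : (∑ b, σ i b * (u b + U i)) + dp i * (U i + V i) +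
        (dp i * U i + (∑ b, σ i b * (v b + V i)) + dp i * V i) = 0 := h
    have e1 : (∑ b, σ i b * (u b + U i)) + (∑ b, σ i b * (v b + V i)) =
        (∑ b, σ i b * (u b + v b)) + (∑ b, σ i b) * (U i + V i) := by
      rw [Finset.sum_mul, ← Finset.sum_add_distrib, ← Finset.sum_add_distrib]
      exact Finset.sum_congr rfl fun b _ => by ring
    have hUV : U i + V i = U0 + V0 := hWi
    rw [hUV] at e1
    set S1 := ∑ b, σ i b * (u b + U i) with hS1
    set S2 := ∑ b, σ i b * (v b + V i) with hS2
    set S3 := ∑ b, σ i b * (u b + v b) with hS3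
    set S4 := ∑ b, σ i b with hS4
    linear_combination (norm := skip) h' - e1
    ring_nf
    try reduce_mod_char
  have ha := hU (fun b => u b + U0) (fun b => u b + v b) (U0 + V0) (fun i => U i + U0) E1 E2 E3 E4
  intro i
  exact (zmod_two_eq_iff_add_eq_zero _ _).mpr (ha i)

/-- ★★ **THE TWO-STAGE DESIGN CRITERION** (order `w`, `u`): under (W), (U) and (F), Monsky's odd matrix of `(base, c₁ :: rest, pat)` has `det = 1` for
EVERY mutual pattern — for designs with any number of free cells, in particular `τ = κ_u + ε > τ₀` (the exceptional class).
[cite: HeathBrown1994SelmerCongruentII, Appendix (Monsky), typescript p. 39 L27–L33] -/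
theorem det_dataK_design_eq_one_of_stages (hm1 : negNegOne c₁.1 = true) (hmr : ∀ i : Fin rest.length, negNegOne (rest.getD i.val (0, 0)).1 = false)
    (σ : Fin rest.length → Fin (k + 1) → ZMod 2) (hσ : ∀ i b, bz ((rest.getD i.val (0, 0)).2.testBit b.val) = σ i b)
    (hσ1 : ∀ b : Fin (k + 1), bz (c₁.2.testBit b.val) = bz (negNegOne (base.cls b)) + ∑ i, σ i b)
    (dp : Fin rest.length → ZMod 2) (hdp : ∀ i, bz (negTwo (rest.getD i.val (0, 0)).1) = dp i)
    (hd1 : bz (negTwo c₁.1) = ∑ i, dp i)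
    (hW : ∀ a e : Fin rest.length → ZMod 2,
      (∀ x y : Fin (k + 1) → ZMod 2, (∀ i, (∑ j, bz (base.neg i j) * (x j + x i)) + bz (negNegOne (base.cls i)) * x i + bz (negTwo (base.cls i)) * y i = 0) →
        (∀ i, bz (negNegOne (base.cls i)) * x i + ∑ j, bz (base.neg i j) * (y j + y i) = 0) →
        (∑ i, (a i * (∑ b, σ i b * y b) + e i * (∑ b, σ i b * x b))) = 0) →
      (∑ i, ((∑ b, σ i b) * a i + dp i * e i)) = 0 → ∀ i, e i = 0)
    (hU : ∀ (x y : Fin (k + 1) → ZMod 2) (γ : ZMod 2) (a : Fin rest.length → ZMod 2),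
      (∀ b, (∑ b', bz (base.neg b b') * (x b' + x b)) + bz (negNegOne (base.cls b)) * x b + bz (negTwo (base.cls b)) * y b =
        ∑ i, σ i b * a i) →
      (∀ b, bz (negNegOne (base.cls b)) * x b + (∑ b', bz (base.neg b b') * (y b' + y b)) = 0) →
      (∑ i, (∑ b, σ i b) * a i) = 0 → (∀ i, (∑ b, σ i b * y b) + γ * ∑ b, σ i b = 0) → ∀ i, a i = 0)
    (hF : ∀ (x y : Fin (k + 1) → ZMod 2) (γ : ZMod 2), (∀ i, (∑ j, bz (base.neg i j) * (x j + x i)) + bz (negNegOne (base.cls i)) * x i + bz (negTwo (base.cls i)) * y i = 0) →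
        (∀ i, bz (negNegOne (base.cls i)) * x i + ∑ j, bz (base.neg i j) * (y j + y i) = 0) →
        (∀ i, (∑ b, σ i b * x b) + γ * dp i = 0) → (∀ i, (∑ b, σ i b * y b) + γ * ∑ b, σ i b = 0) →
        γ = 0 ∧ x = 0 ∧ y = 0)
    (pat : ℕ → ℕ → Bool) : (dataK base (c₁ :: rest) pat).monskyOddS.det = 1 := by
  classical
  have h20 : ((2 : ℕ) = 0) = False := by simp
  have h21 : ((2 : ℕ) = 1) = False := by simp
  have auxIdx : ∀ i : Fin (k + 1 + (c₁ :: rest).length), auxQ k (c₁ :: rest).length i = true →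
      ∃ j : Fin (c₁ :: rest).length, i = Fin.natAdd (k + 1) j := by
    intro i hi
    induction i using Fin.addCases with
    | left b => rw [auxQ_castAdd] at hi; exact absurd hi (by simp)
    | right j => exact ⟨j, rfl⟩
  -- w-constancy of every auxiliary index relative to q₁, from the x-free data
  have STW : ∀ z : Fin (k + 1 + (c₁ :: rest).length) ⊕ Fin (k + 1 + (c₁ :: rest).length) → ZMod 2,
      (∀ i, auxQ k (c₁ :: rest).length i = false →
        ((dataK base (c₁ :: rest) (fun _ _ => false)).monskyOddS *ᵥ z) (Sum.inl i) = 0 ∧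
        ((dataK base (c₁ :: rest) (fun _ _ => false)).monskyOddS *ᵥ z) (Sum.inr i) = 0) →
      (∑ i ∈ Finset.univ.filter (fun i => auxQ k (c₁ :: rest).length i = true),
        ((dataK base (c₁ :: rest) (fun _ _ => false)).monskyOddS *ᵥ z) (Sum.inl i)) = 0 →
      (∑ i ∈ Finset.univ.filter (fun i => auxQ k (c₁ :: rest).length i = true),
        ((dataK base (c₁ :: rest) (fun _ _ => false)).monskyOddS *ᵥ z) (Sum.inr i)) = 0 →
      ∀ j : Fin (c₁ :: rest).length, z (Sum.inl (Fin.natAdd (k + 1) j)) + z (Sum.inr (Fin.natAdd (k + 1) j)) =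
        z (Sum.inl (Fin.natAdd (k + 1) (⟨0, by simp⟩ : Fin (c₁ :: rest).length))) +
          z (Sum.inr (Fin.natAdd (k + 1) (⟨0, by simp⟩ : Fin (c₁ :: rest).length))) := by
    intro z hout hs1 hs2 j
    rw [sum_filter_auxQ] at hs1 hs2
    have hw := design_stageW base c₁ rest hm1 hmr σ hσ hσ1 dp hdp hd1 hW z
      (fun b => (hout _ (auxQ_castAdd _ b)).1) (fun b => (hout _ (auxQ_castAdd _ b)).2) hs1 hs2
    rcases fin_cons_cases c₁ rest j with rfl | ⟨i, rfl⟩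
    · rfl
    · exact hw i
  refine SymbData.det_monskyOddS_eq_one_of_staged_constancy (agreeOffAux_dataK base (c₁ :: rest) (fun _ _ => false) pat)
    (δ₁ := 2) (δ₂ := 0) (by omega) (by omega) (by omega) ?_ ?_ ?_
  · -- stage one, direction w
    intro z hout hs1 hs2 i j hi hj
    simp only [h20, h21, if_false]
    obtain ⟨i', rfl⟩ := auxIdx i hi
    obtain ⟨j', rfl⟩ := auxIdx j hj
    exact (STW z hout hs1 hs2 i').trans (STW z hout hs1 hs2 j').symm
  · -- stage two, direction u, given the w-rows
    intro z hout hs1 hs2 hwrows i j hi hj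
    simp only [if_true]
    simp only [h20, h21, if_false] at hwrows
    have hs1' := hs1
    have hs2' := hs2
    rw [sum_filter_auxQ] at hs1' hs2'
    have hw : ∀ i : Fin rest.length,
        z (Sum.inl (Fin.natAdd (k + 1) (⟨i.val + 1, by simp⟩ : Fin (c₁ :: rest).length))) +
          z (Sum.inr (Fin.natAdd (k + 1) (⟨i.val + 1, by simp⟩ : Fin (c₁ :: rest).length))) =
        z (Sum.inl (Fin.natAdd (k + 1) (⟨0, by simp⟩ : Fin (c₁ :: rest).length))) +
          z (Sum.inr (Fin.natAdd (k + 1) (⟨0, by simp⟩ : Fin (c₁ :: rest).length))) := fun i => STW z hout hs1 hs2 _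
    have hwr : ∀ j : Fin (c₁ :: rest).length,
        ((dataK base (c₁ :: rest) (fun _ _ => false)).monskyOddS *ᵥ z) (Sum.inl (Fin.natAdd (k + 1) j)) +
        ((dataK base (c₁ :: rest) (fun _ _ => false)).monskyOddS *ᵥ z) (Sum.inr (Fin.natAdd (k + 1) j)) = 0 :=
      fun j => hwrows (Fin.natAdd (k + 1) j) (auxQ_natAdd _ j)
    have hu := design_stageU base c₁ rest hm1 hmr σ hσ hσ1 dp hdp hd1 hU z
      (fun b => (hout _ (auxQ_castAdd _ b)).1) (fun b => (hout _ (auxQ_castAdd _ b)).2) hs1' hs2' hw hwr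
    have hu0 : ∀ j : Fin (c₁ :: rest).length, z (Sum.inl (Fin.natAdd (k + 1) j)) =
        z (Sum.inl (Fin.natAdd (k + 1) (⟨0, by simp⟩ : Fin (c₁ :: rest).length))) := by
      intro j'
      rcases fin_cons_cases c₁ rest j' with rfl | ⟨i', rfl⟩
      · rfl
      · exact hu i'
    obtain ⟨i', rfl⟩ := auxIdx i hi
    obtain ⟨j', rfl⟩ := auxIdx j hj
    exact (hu0 i').trans (hu0 j').symm
  · -- stage three
    intro z hconst hz
    exact design_S3 base c₁ rest hm1 hmr σ hσ hσ1 dp hdp hd1 hF z hconst hz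

/-- ★★ **Packaged form of the two-stage criterion**: the design passes the Heegner check and wins for every mutual pattern.
[cite: HeathBrown1994SelmerCongruentII, Appendix (Monsky), typescript p. 39 L27–L33] -/
theorem design_recipe_of_stages (hm1 : negNegOne c₁.1 = true) (hmr : ∀ i : Fin rest.length, negNegOne (rest.getD i.val (0, 0)).1 = false)
    (σ : Fin rest.length → Fin (k + 1) → ZMod 2) (hσ : ∀ i b, bz ((rest.getD i.val (0, 0)).2.testBit b.val) = σ i b)
    (hσ1 : ∀ b : Fin (k + 1), bz (c₁.2.testBit b.val) = bz (negNegOne (base.cls b)) + ∑ i, σ i b)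
    (dp : Fin rest.length → ZMod 2) (hdp : ∀ i, bz (negTwo (rest.getD i.val (0, 0)).1) = dp i)
    (hd1 : bz (negTwo c₁.1) = ∑ i, dp i)
    (hW : ∀ a e : Fin rest.length → ZMod 2,
      (∀ x y : Fin (k + 1) → ZMod 2, (∀ i, (∑ j, bz (base.neg i j) * (x j + x i)) + bz (negNegOne (base.cls i)) * x i + bz (negTwo (base.cls i)) * y i = 0) →
        (∀ i, bz (negNegOne (base.cls i)) * x i + ∑ j, bz (base.neg i j) * (y j + y i) = 0) →
        (∑ i, (a i * (∑ b, σ i b * y b) + e i * (∑ b, σ i b * x b))) = 0) →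
      (∑ i, ((∑ b, σ i b) * a i + dp i * e i)) = 0 → ∀ i, e i = 0)
    (hU : ∀ (x y : Fin (k + 1) → ZMod 2) (γ : ZMod 2) (a : Fin rest.length → ZMod 2),
      (∀ b, (∑ b', bz (base.neg b b') * (x b' + x b)) + bz (negNegOne (base.cls b)) * x b + bz (negTwo (base.cls b)) * y b =
        ∑ i, σ i b * a i) →
      (∀ b, bz (negNegOne (base.cls b)) * x b + (∑ b', bz (base.neg b b') * (y b' + y b)) = 0) →
      (∑ i, (∑ b, σ i b) * a i) = 0 → (∀ i, (∑ b, σ i b * y b) + γ * ∑ b, σ i b = 0) → ∀ i, a i = 0)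
    (hF : ∀ (x y : Fin (k + 1) → ZMod 2) (γ : ZMod 2), (∀ i, (∑ j, bz (base.neg i j) * (x j + x i)) + bz (negNegOne (base.cls i)) * x i + bz (negTwo (base.cls i)) * y i = 0) →
        (∀ i, bz (negNegOne (base.cls i)) * x i + ∑ j, bz (base.neg i j) * (y j + y i) = 0) →
        (∀ i, (∑ b, σ i b * x b) + γ * dp i = 0) → (∀ i, (∑ b, σ i b * y b) + γ * ∑ b, σ i b = 0) →
        γ = 0 ∧ x = 0 ∧ y = 0) :
    heegnerK base (c₁ :: rest) = true ∧ ∀ pat : ℕ → ℕ → Bool, (dataK base (c₁ :: rest) pat).monskyOddS.det = 1 := by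
  refine ⟨heegnerK_design base c₁ rest hm1 hmr ?_ ?_,
    fun pat => det_dataK_design_eq_one_of_stages base c₁ rest hm1 hmr σ hσ hσ1 dp hdp hd1 hW hU hF pat⟩
  · rw [hd1]; exact Finset.sum_congr rfl fun i _ => (hdp i).symm
  · intro b; rw [hσ1 b]; exact congrArg _ (Finset.sum_congr rfl fun i _ => (hσ i b).symm)

end DesignTwoStage

end Summit.BirchSwinnertonDyer.BirchSwinnertonDyer.Theorems.SymbolicMonsky
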